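import Summits.BirchSwinnertonDyer.BirchSwinnertonDyer.Theorems.EisensteinDepletionAtTwoStarOptBSFSigmaNodeSeventeen
import Summits.BirchSwinnertonDyer.BirchSwinnertonDyer.Theorems.EisensteinDepletionAtTwoStarOptBSFSigmaNodeFifteenFree
import Summits.BirchSwinnertonDyer.BirchSwinnertonDyer.Theorems.EisensteinDepletionAtTwoStarOptBSFSeventeenClassWalk
import Summits.BirchSwinnertonDyer.BirchSwinnertonDyer.Theorems.EisensteinDepletionAtTwoStarOptBNSFStubIsogenyFactor
import Summits.BirchSwinnertonDyer.BirchSwinnertonDyer.Theorems.EisensteinDepletionAtTwoStarOptBNSFStubOddIsoArch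
import Summits.BirchSwinnertonDyer.BirchSwinnertonDyer.Theorems.EisensteinDepletionAtTwoStarOptBNSFStubOddIsoTwoAdic
import Literature.NumberTheory.EllipticCurves.ManinConstantPotMultiplicativeProofs
import HarnessLib

/-!
# Line `star` on crux E1M (stmt-BirchSwinnertonDyer-20341): the `−256` branch WITHOUT Cremona's conductor-17 table, and (T2′) from UBD + Edixhoven + (N256) alone

Lead star-p1 GEN 19.  Theorems/…StarOptBSFSigmaNodeSeventeen (GEN 17) closed the `−256` branch of the MID-walk residue modulo the PRINT
`Cremona1997_conductor_seventeen_classification`: the shape `α = ±30`, `β = 289/8`, `Δ(W₀) = −17⁴` forces the level `17`, where Cremona's table shows no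
habitat curve.  The table is not needed:
1. `α = −30` is impossible on an INTEGRAL model: `c₆ = −α³ + 36αβ = −12015 ≡ 1 (mod 4)`, whereas `c₆ = −b₂³ + 36b₂b₄ − 216b₆ ≡ −a₁⁶ ∈ {0, 3} (mod 4)`
   (`c₆_integralModel_ne`);
2. `α = 30` pins `(c₄, c₆)(W₀) = (33, 12015) = (c₄, c₆)(17a1)`, so `W₀ ≅ 17a1` over `ℚ` (tree `exists_variableChange_of_c₄_eq_of_c₆_eq'`);
3. the habitat curve `W` is isogenous to `W₀` (same newform; Faltings, tree `isIsogenous_iff_frobeniusTrace_eq_holds`), the isogeny factors through a globally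
   minimal `V` as (2-power `W₀ → V`) and (odd `W → V`) (tree `stub_isogenyFactor`), `V ≅` one of `17a1–17a4` by the EXPLICIT walk
   (`SeventeenClass.exists_smul_mem_of_twoPower_isogeny`), odd isogenies transport the unique rational `2`-torsion point with both Greenberg type bits (tree
   `stub_oddIsoUnique/Arch/TwoAdic`), and the tree's case analysis `not_prop514_of_smul_eq_cremona17` on the four models contradicts the habitat type of `W`.
Together with the Setzer-free `+256` branch (…SigmaNodeFifteenFree) this gives
  **(T2′) ⇐ (N256) + PRINTS {UBD, Edixhoven}** (`partnerNotCentre_of_sigmaNode_free`),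
so line `star` v14 has FIVE print stubs {(F) cusp non-singularity, Edixhoven, Γ₁-datum, Abbes–Ullmo, UBD} — the two classification prints are gone.

CONDITIONAL on UBD + Edixhoven (THEOREM A) and on (N256) where stated; no `sorry`, no new definition; nothing here reads `r_an`; StarOptB / E1M / BSD are NOT
proved (PARTITION D-0054: none — r_an ≥ 2 axis S0; no S0 motion).
-/

set_option linter.dupNamespace false
set_option autoImplicit false

noncomputable section

open scoped Classical MatrixGroups
open CongruenceSubgroup
open WeierstrassCurve Literature.NumberTheory.EllipticCurves Literature.NumberTheory.EllipticCurves.Greenberg1999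
open Literature.NumberTheory.EllipticCurves.ModularForms
open Summit.BirchSwinnertonDyer.BirchSwinnertonDyer.Theorems.DepletionAtTwo.NsfStubs
open Summit.BirchSwinnertonDyer.BirchSwinnertonDyer.Theorems.EisensteinDepletionAtTwoStarOptBNSFStubIsogenyFactor

namespace Summit.BirchSwinnertonDyer.BirchSwinnertonDyer.Theorems.DepletionAtTwo.SigmaNode

/-! ### §1 `c₆ mod 4` on an integral model -/

/-- Over `ℤ/4`, `c₆ = −b₂³ + 36b₂b₄ − 216b₆ = −a₁⁶`. [cite: SilvermanAEC2009, III.1 (formulas for b₂, c₆)] -/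
theorem c₆_zmod_four (V : WeierstrassCurve (ZMod 4)) : V.c₆ = -V.a₁ ^ 6 := by
  obtain ⟨a₁, a₂, a₃, a₄, a₆⟩ := V
  simp only [WeierstrassCurve.c₆, WeierstrassCurve.b₂, WeierstrassCurve.b₄, WeierstrassCurve.b₆]
  revert a₁ a₂ a₃ a₄ a₆
  decide

/-- **`c₆ ≢ 1 (mod 4)` on a globally minimal (hence integral) model**: in particular `c₆ ≠ −12015`. [cite: SilvermanAEC2009, III.1 and VIII.8] -/
theorem c₆_ne_neg_12015 (W : WeierstrassCurve ℚ) [W.IsGloballyMinimal] : W.c₆ ≠ -12015 := by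
  intro h
  have hc : ((integralModelInt W).c₆ : ℚ) = W.c₆ := by
    have h' := (integralModelInt W).map_c₆ (Int.castRingHom ℚ)
    rw [map_integralModelInt, eq_intCast] at h'
    exact h'.symm
  have hint : (integralModelInt W).c₆ = -12015 := by
    have : ((integralModelInt W).c₆ : ℚ) = ((-12015 : ℤ) : ℚ) := by rw [hc, h]; norm_num
    exact_mod_cast this
  have key := c₆_zmod_four ((integralModelInt W).map (Int.castRingHom (ZMod 4)))
  rw [WeierstrassCurve.map_c₆, hint, WeierstrassCurve.map_a₁, eq_intCast, eq_intCast] at key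
  push_cast at key
  have hbad : ∀ a : ZMod 4, -(12015 : ZMod 4) ≠ -a ^ 6 := by decide
  exact hbad _ key

/-! ### §2 The `17a1` shape pins `W₀` up to `ℚ`-isomorphism -/

/-- `c₄ = α² − 24β` and `c₆ = −α³ + 36αβ` at a rational `2`-torsion abscissa `x` (`α = b₂ + 12x`, `β = b₄ + x b₂ + 6x²`: the invariants of the shifted
model with the point at `(0, 0)`, whose `b₆` vanishes). [cite: SilvermanAEC2009, III.1 Table 3.1] -/
theorem c₄_c₆_eq_of_twoTorsion (W₀ : WeierstrassCurve ℚ) {x : ℚ} (hx : HasRationalTwoTorsionX W₀ x) :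
    W₀.c₄ = (W₀.b₂ + 12 * x) ^ 2 - 24 * (W₀.b₄ + x * W₀.b₂ + 6 * x ^ 2) ∧
      W₀.c₆ = -(W₀.b₂ + 12 * x) ^ 3 + 36 * (W₀.b₂ + 12 * x) * (W₀.b₄ + x * W₀.b₂ + 6 * x ^ 2) := by
  obtain ⟨y, hE, h2⟩ := hx
  have hcub := fourXCubed_add_eq_zero_of_twoTorsion hE h2
  refine ⟨?_, ?_⟩
  · simp only [WeierstrassCurve.c₄]; ring
  · simp only [WeierstrassCurve.c₆]
    linear_combination (-216 : ℚ) * hcub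

/-- **The `−256`/`α = ±30` shape is the `17a1` shape**: on a globally minimal `W₀` it forces `C • W₀ = 17a1 = [1,−1,1,−1,−14]` for some change of variables
(`α = −30` would give `c₆ = −12015 ≡ 1 (mod 4)`, impossible; `α = 30` gives `(c₄, c₆) = (33, 12015)`). [cite: SilvermanAEC2009, III.1 Table 3.1] [cite: CremonaAlgorithms1997, Table 1 (17a1)] -/
theorem exists_smul_eq_17a1_of_seventeenShape (W₀ : WeierstrassCurve ℚ) [W₀.IsElliptic] [W₀.IsGloballyMinimal]
    {x₀ : ℚ} (hx₀ : HasRationalTwoTorsionX W₀ x₀)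
    (hneg : (W₀.b₂ + 12 * x₀) ^ 2 - 32 * (W₀.b₄ + x₀ * W₀.b₂ + 6 * x₀ ^ 2) = -256)
    (hα : W₀.b₂ + 12 * x₀ = 30 ∨ W₀.b₂ + 12 * x₀ = -30) :
    ∃ C : VariableChange ℚ, C • W₀ = ⟨1, -1, 1, -1, -14⟩ := by
  obtain ⟨hc₄, hc₆⟩ := c₄_c₆_eq_of_twoTorsion W₀ hx₀
  have hsq : (W₀.b₂ + 12 * x₀) ^ 2 = 900 := by rcases hα with h | h <;> rw [h] <;> norm_num
  have hβ : W₀.b₄ + x₀ * W₀.b₂ + 6 * x₀ ^ 2 = 289 / 8 := by linarith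
  have h4 : W₀.c₄ = 33 := by rw [hc₄, hsq, hβ]; norm_num
  rcases hα with h30 | hm30
  · have h6 : W₀.c₆ = 12015 := by rw [hc₆, hβ, h30]; norm_num
    have hM4 : (⟨1, -1, 1, -1, -14⟩ : WeierstrassCurve ℚ).c₄ = 33 := by
      simp only [WeierstrassCurve.c₄, WeierstrassCurve.b₂, WeierstrassCurve.b₄]; norm_num
    have hM6 : (⟨1, -1, 1, -1, -14⟩ : WeierstrassCurve ℚ).c₆ = 12015 := by
      simp only [WeierstrassCurve.c₆, WeierstrassCurve.b₂, WeierstrassCurve.b₄, WeierstrassCurve.b₆]; norm_num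
    exact exists_variableChange_of_c₄_eq_of_c₆_eq' (w := (1 : ℚ)) one_ne_zero (by rw [hM4, h4]; norm_num) (by rw [hM6, h6]; norm_num)
  · exfalso
    have h6 : W₀.c₆ = -12015 := by rw [hc₆, hβ, hm30]; norm_num
    exact c₆_ne_neg_12015 W₀ h6

/-! ### §3 The `−256` branch, Cremona-free -/

/-- **`−256` and `α = ±30` on the lattice-optimal curve of a habitat class is impossible — WITHOUT Cremona's table.**  `W₀ ≅ 17a1`; `W ~ W₀` (Faltings); factor
through a globally minimal `V` (2-power from `W₀`, odd from `W`); `V ≅ 17aⱼ` by the explicit walk; the odd isogeny `W → V` carries the unique rational `2`-torsion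
point of `W` with its type bits to the unique one of `V`; no model `17aⱼ` carries a point of type A xor B (`not_prop514_of_smul_eq_cremona17`).
[cite: SilvermanAEC2009, Cor. III.4.11 and III.4 Example 4.5] [cite: GreenbergLNM1716, §5 Prop. 5.14] [cite: CremonaAlgorithms1997, Table 1 (N = 17)] -/
theorem false_of_seventeenShape_free
    (W : WeierstrassCurve ℚ) [W.IsElliptic] [W.IsGloballyMinimal] {x : ℚ} (hord : IsOrdinaryAt W 2) (hux : HasUniqueRationalTwoTorsionX W x)
    (htype : (TwoTorsionRamifiedAtTwo x ∧ ¬ TwoTorsionOdd W x) ∨ (TwoTorsionOdd W x ∧ ¬ TwoTorsionRamifiedAtTwo x))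
    {N : ℕ} [NeZero N] (f : CuspForm (Gamma0 N) 2) (hW : IsNewformOf W f)
    (W₀ : WeierstrassCurve ℚ) [W₀.IsElliptic] [W₀.IsGloballyMinimal] (hW₀ : IsNewformOf W₀ f)
    {x₀ : ℚ} (hx₀ : HasRationalTwoTorsionX W₀ x₀)
    (hneg : (W₀.b₂ + 12 * x₀) ^ 2 - 32 * (W₀.b₄ + x₀ * W₀.b₂ + 6 * x₀ ^ 2) = -256)
    (hα : W₀.b₂ + 12 * x₀ = 30 ∨ W₀.b₂ + 12 * x₀ = -30) : False := by
  obtain ⟨C₀, hC₀⟩ := exists_smul_eq_17a1_of_seventeenShape W₀ hx₀ hneg hα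
  have hiso : WeierstrassCurve.IsIsogenous W₀ W :=
    IsNewformOf.isIsogenous WeierstrassCurve.isIsogenous_iff_frobeniusTrace_eq_holds hW₀ hW
  obtain ⟨V, hV, hVmin, φ₁, ψ, hk, hodd⟩ := stub_isogenyFactor W₀ W hiso
  haveI := hV
  haveI := hVmin
  obtain ⟨C, M, hM, hCV⟩ := SeventeenClass.exists_smul_mem_of_twoPower_isogeny W₀ V φ₁ hk C₀ (Or.inl hC₀)
  obtain ⟨x', hx'⟩ := stub_oddIsoUnique W V ψ hodd x hux
  have hO := stub_oddIsoArch W V ψ hodd x x' hux hx'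
  have hR := stub_oddIsoTwoAdic W V ψ hodd hord x x' hux hx'
  have htype' : (TwoTorsionRamifiedAtTwo x' ∧ ¬ TwoTorsionOdd V x') ∨ (TwoTorsionOdd V x' ∧ ¬ TwoTorsionRamifiedAtTwo x') := by
    rcases htype with ⟨hr, ho⟩ | ⟨ho, hr⟩
    · exact Or.inl ⟨hR.mp hr, fun h ↦ ho (hO.mpr h)⟩
    · exact Or.inr ⟨hO.mp ho, fun h ↦ hr (hR.mpr h)⟩
  have hC : C • V = (⟨1, -1, 1, -1, -14⟩ : WeierstrassCurve ℚ) ∨ C • V = (⟨1, -1, 1, -6, -4⟩ : WeierstrassCurve ℚ) ∨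
      C • V = (⟨1, -1, 1, -91, -310⟩ : WeierstrassCurve ℚ) ∨ C • V = (⟨1, -1, 1, -1, 0⟩ : WeierstrassCurve ℚ) := by
    rcases hM with rfl | rfl | rfl | rfl
    · exact Or.inl hCV
    · exact Or.inr (Or.inl hCV)
    · exact Or.inr (Or.inr (Or.inl hCV))
    · exact Or.inr (Or.inr (Or.inr hCV))
  exact not_prop514_of_smul_eq_cremona17 V C hC hx' htype'

/-! ### §4 (T2′) from (N256) and the prints UBD + Edixhoven alone -/

/-- **(T2′) «the MID point's 2-isogenous partner is not a centre» from the node law (N256) and TWO PRINTS (UBD, Edixhoven: THEOREM A)** — the statement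
of `partnerNotCentre_of_sigmaNode_of_prints` WITHOUT the Setzer and Cremona-17 binders: `+256` branch by `false_of_fifteenShape_free`, `−256` branch by
`false_of_seventeenShape_free`.  CONDITIONAL on the two prints and on (N256).
[cite: CalegariDimitrovTang2025, Thm. 1.0.1] [cite: Edixhoven1991, Prop. 2] [cite: GreenbergLNM1716, §5 Props. 5.13–5.14] -/
theorem partnerNotCentre_of_sigmaNode_free
    (hU : Literature.NumberTheory.Automorphic.CalegariDimitrovTang2025_unboundedDenominators)
    (hEd : edixhoven_optimalManinConstant_integral)
    (hN : ∀ (W₀ : WeierstrassCurve ℚ) [W₀.IsElliptic] [W₀.IsGloballyMinimal]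
      ⦃N : ℕ⦄ [NeZero N] (f : CuspForm (Gamma0 N) 2), IsNewformOf W₀ f → IsOrdinaryAt W₀ 2 →
      ∀ (L₀ : PeriodPair), IsNeronLatticeOf (W₀.baseChange ℂ) L₀ → ∀ (q : ℚ), q ≠ 0 →
      (∀ z ∈ periodLattice f, (q : ℂ) * z ∈ L₀.lattice) → (∀ z ∈ L₀.lattice, ∃ w ∈ periodLattice f, z = (q : ℂ) * w) →
      ∀ (x : ℚ), HasRationalTwoTorsionX W₀ x → TwoTorsionRamifiedAtTwo x →
      ∀ (lam : ℂ), lam ∈ L₀.lattice → lam / 2 ∉ L₀.lattice →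
        L₀.weierstrassP (lam / 2) - ((W₀.b₂ : ℚ) : ℂ) / 12 = ((x : ℚ) : ℂ) →
      (∀ (γ : SL(2, ℤ)) (hγ : γ ∈ Gamma0 N), γ ∈ Gamma1 N →
        ∃ k : ℤ, ∃ w ∈ L₀.lattice, (q : ℂ) * cuspSymbol f ⟨γ, hγ⟩ = (k : ℂ) * lam + 2 * w) →
      (W₀.b₂ + 12 * x) ^ 2 - 32 * (W₀.b₄ + x * W₀.b₂ + 6 * x ^ 2) = 256 ∨
        (W₀.b₂ + 12 * x) ^ 2 - 32 * (W₀.b₄ + x * W₀.b₂ + 6 * x ^ 2) = -256) :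
    ∀ (W : WeierstrassCurve ℚ) [W.IsElliptic] [W.IsGloballyMinimal] (x : ℚ), IsOrdinaryAt W 2 →
      HasUniqueRationalTwoTorsionX W x →
      ((TwoTorsionRamifiedAtTwo x ∧ ¬ TwoTorsionOdd W x) ∨ (TwoTorsionOdd W x ∧ ¬ TwoTorsionRamifiedAtTwo x)) →
      W.conductorNorm ℤ ≠ 15 → Squarefree (W.conductorNorm ℤ) →
      ∀ ⦃N : ℕ⦄ [NeZero N] (f : CuspForm (Gamma0 N) 2), IsNewformOf W f →
      ∀ (W₀ : WeierstrassCurve ℚ) [W₀.IsElliptic] [W₀.IsGloballyMinimal], IsNewformOf W₀ f →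
      ∀ (L₀ : PeriodPair), IsNeronLatticeOf (W₀.baseChange ℂ) L₀ → ∀ (q : ℚ), q ≠ 0 →
      (∀ z ∈ periodLattice f, (q : ℂ) * z ∈ L₀.lattice) → (∀ z ∈ L₀.lattice, ∃ w ∈ periodLattice f, z = (q : ℂ) * w) →
      ∀ (x₀ : ℚ), HasRationalTwoTorsionX W₀ x₀ → TwoTorsionRamifiedAtTwo x₀ → TwoTorsionOdd W₀ x₀ →
      ¬ IsSquare ((W₀.b₄ + x₀ * W₀.b₂ + 6 * x₀ ^ 2) / 2) := by
  intro W _ _ x hord hux htype h15 hsf N _ f hW W₀ _ _ hW₀ L₀ hL₀ q hq hin hout x₀ hx₀ hR₀ hO₀ hsq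
  have hiso : WeierstrassCurve.IsIsogenous W W₀ :=
    IsNewformOf.isIsogenous WeierstrassCurve.isIsogenous_iff_frobeniusTrace_eq_holds hW hW₀
  have hord₀ : IsOrdinaryAt W₀ 2 := Summit.BirchSwinnertonDyer.BirchSwinnertonDyer.Theorems.IsogenyMuShift.isOrdinaryAt_of_isIsogenous hiso hord
  obtain ⟨lam, hlam, hlam2, hwp⟩ := exists_half_period_of_hasRationalTwoTorsionX W₀ L₀ hL₀ hx₀
  have hpar := ThmAFormal.kummerParity_formal_of_mem_gamma1 hU hEd W₀ f hW₀ L₀ hL₀ q hq hin hout x₀ hx₀ hR₀ lam hlam hlam2 hwp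
  rcases hN W₀ f hW₀ hord₀ L₀ hL₀ q hq hin hout x₀ hx₀ hR₀ lam hlam hlam2 hwp hpar with h256 | hneg
  · have hα := alpha_eq_neg_of_mid_of_isSquare W₀ hord₀.1 hx₀ hR₀ hO₀ h256 hsq
    exact false_of_fifteenShape_free W h15 hsf f hW W₀ hW₀ hx₀ h256 hα
  · have hα := alpha_eq_of_complDisc_eq_neg_of_isSquare W₀ hord₀.1 hx₀ hR₀ hneg hsq
    exact false_of_seventeenShape_free W hord hux htype f hW W₀ hW₀ hx₀ hneg hα

end Summit.BirchSwinnertonDyer.BirchSwinnertonDyer.Theorems.DepletionAtTwo.SigmaNode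

end
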